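import Summits.AtomisticToContinuum.Crystallization.Theorems.PalmUnimodularRigidityMinimiserShellsCapAssembly
import Summits.AtomisticToContinuum.Crystallization.Theorems.PalmUnimodularRigidityMinimiserShellsDefectTransportSent
import Summits.AtomisticToContinuum.Crystallization.Theorems.PalmUnimodularRigidityMinimiserShellsDefectTransportReceived
import Summits.AtomisticToContinuum.Crystallization.Theorems.PalmUnimodularRigidityMinimiserShellsSurchargedReceived
import Summits.AtomisticToContinuum.Crystallization.Theorems.PalmUnimodularRigidityMinimiserShellsMeckePricing

/-!
# Local-defect certificates: pointwise energy certificates and pricing from a finite defect inequality,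
# for an ARBITRARY local predicate (stub `stub_localDefectCertificates`)
(line `octahedral-annulus-mandate` of crux `MinimiserShells`, stmt-AtomisticToContinuum-9225)

Route `PalmUnimodularRigidity`, crux decl
`Summit.AtomisticToContinuum.Crystallization.Theses.PalmUnimodularRigidity.MinimiserShells`.

This is `CapAssembly.stub_capAssembly` (the cap certificates from the finite cap inequality) with the specific
radius-`2`-local predicate `Capped` replaced by an arbitrary predicate `G` of configurations which is LOCAL at
some radius `r > 0` (`G μ` only depends on the atoms of `μ` in `B̄(0, r)`) and has a MEASURABLE PROXY `B` on
finite counting measures (`count|F ∈ B ↔ G (count|F)` for finite `F`).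

**Theorem** (`stub_localDefectCertificates`).  If for some `c > 0` and hard core `δ > 0` every finite injective
`δ`-separated cluster `y : Fin N → ℝ³` satisfies the FINITE DEFECT INEQUALITY
`N·e* + c·#{i | ¬ G (cluster re-rooted at y i)} ≤ 𝓔_N(y)`, then for every `ε > 0` there is an admissible
transfer `t` (`Cap.IsTransfer`: jointly measurable, bounded, finite range) with `e* − ε ≤ h + div t` at every
rooted `δ`-hard-core configuration and `e* + c/2 ≤ h + div t` at every one with `¬ G`.

**Corollary** (`pricing_of_finiteInequality`, through the Mecke pricing lemma
`MeckePricing.stub_meckePricing_unfolded` and `ε → 0`): `e* + (c/2)·P{¬ G} ≤ E_P[h]` for every point-stationary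
almost surely `δ`-hard-core probability law `P`.

**Proof.**  Verbatim `CapAssembly.assembly` — the random-grid transport of item 9229 at the class parameter
`δ₀ = min δ (1/20)` plus the DEFECT TRANSPORT read through `B` (`DefectTransportSent.stub_defectTransportSent`,
`DefectTransportReceived.stub_defectTransportReceived`, `SurchargedReceived.stub_surchargedReceived`, all generic
in `B`; pointwise bookkeeping `CapAssembly.certificate`) — with the one `Capped`-specific step, the cap bonus,
re-proved at radius `r` (`local_bonus`): off the six phase slabs of width `r/L` the ball `B̄(0, r)` lies in
the root's cell (`closedBall_subset_rootCell`), where by locality "the (finite) cell cluster is not in `B`" is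
"`¬ G μ`"; so at a `¬ G` root the received defect mass is `≥ c·(vol [0,1)³ − 6r/L) ≥ (3/4)·c·vol` once the
mesh has `L ≥ 24 r / vol`.
-/

noncomputable section

open MeasureTheory Filter Set
open scoped ENNReal BigOperators Topology

namespace Summit.AtomisticToContinuum.Crystallization.Theorems.PalmUnimodularRigidityMinimiserShells.LocalDefectCertificates

open Literature.Probability.Process (IsRootedHardCore IsPointStationaryLaw count_restrict_singleton_ne_zero_iff)
open Literature.MathematicalPhysics.StatisticalMechanics (lennardJones rootEnergy interactionEnergy
  UniformlyDiscrete)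
open Summit.AtomisticToContinuum.Crystallization.Theorems.MinimiserShells.Negative.LoadBearing (eStar meanRootEnergy)
open Summit.AtomisticToContinuum.Crystallization.Theorems.MinimiserShells.Negative.Rootedness (E3)
open Summit.AtomisticToContinuum.Crystallization.Theorems.PalmUnimodularRigidityMinimiserShells.EnergyFloor
open Summit.AtomisticToContinuum.Crystallization.Theorems.PalmUnimodularRigidityMinimiserShells.SlackCertificates
  (transport_eq_zero_of_lt)
open Summit.AtomisticToContinuum.Crystallization.Theorems.PalmUnimodularRigidityMinimiserShells.Cap
  (IsTransfer transferDiv)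
open Summit.AtomisticToContinuum.Crystallization.Theorems.PalmUnimodularRigidityMinimiserShells.CapAssembly
  (neg_cst_le_eStar defect_le defect_eq_zero_of_lt volume_phaseDom_le_add certificate)

/-! ## Off the phase slabs of width `r/L` the ball `B̄(0, r)` lies in the root's cell -/

/-- If every phase coordinate lies in `(r/L, 1 − r/L)` then the whole ball `B̄(0, r)` shares the root's cell
(`CapAssembly.closedBall_two_subset_rootCell` at a general radius). -/
theorem closedBall_subset_rootCell {r L : ℝ} (hL : 0 < L) {v : E3}
    (hv : ∀ i, r / L < v i ∧ v i < 1 - r / L) : Metric.closedBall (0 : E3) r ⊆ rootCell L v := by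
  intro w hw
  rw [mem_closedBall_zero_iff] at hw
  rw [mem_rootCell]
  funext i
  obtain ⟨h1, h2⟩ := hv i
  have hwi : |w i| ≤ r := (by simpa using PiLp.norm_apply_le w i : |w i| ≤ ‖w‖).trans hw
  have hr0 : 0 ≤ r / L := div_nonneg ((abs_nonneg _).trans hwi) hL.le
  have hwi' : |w i / L| ≤ r / L := by
    rw [abs_div, abs_of_pos hL]; exact div_le_div_of_nonneg_right hwi hL.le
  rw [abs_le] at hwi'
  show ⌊w i / L - v i⌋ = ⌊(0 : E3) i / L - v i⌋
  rw [PiLp.zero_apply, zero_div, zero_sub]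
  have hr : ⌊-v i⌋ = -1 := by
    rw [Int.floor_eq_iff]; push_cast; constructor <;> linarith
  rw [hr, Int.floor_eq_iff]; push_cast; constructor <;> linarith

/-! ## The local bonus -/

/-- **The local bonus** (`CapAssembly.cap_bonus` for a general local predicate).  Let `G` be local at radius
`r > 0` and let `B` agree with `G` on finite counting measures.  At a rooted `δ`-hard-core configuration `μ`
with `¬ G μ`, for every phase `v` off the six slabs of width `r/L` the cell cluster `μ|C_v` is a finite
counting measure with the same atoms as `μ` in `B̄(0, r) ⊆ C_v`, hence `¬ G (μ|C_v)`, hence `μ|C_v ∉ B`; so the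
received defect mass `∫_{[0,1)³} c·1[μ|C_v ∉ B] dv` is at least `c·vol [0,1)³ − c·6·(r/L)`. -/
theorem local_bonus {G : Measure E3 → Prop} {r : ℝ} (hr : 0 < r)
    (hloc : ∀ μ ν : Measure E3, (∀ w : E3, ‖w‖ ≤ r → (μ {w} ≠ 0 ↔ ν {w} ≠ 0)) → (G μ ↔ G ν))
    {B : Set (Measure E3)}
    (hBG : ∀ F : Set E3, F.Finite →
      ((Measure.count : Measure E3).restrict F ∈ B ↔ G ((Measure.count : Measure E3).restrict F)))
    (c : ℝ) {δ L : ℝ} (hδ : 0 < δ) (hL : 0 < L) {μ : Measure E3} (hμ : IsRootedHardCore δ μ)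
    (hGμ : ¬ G μ) :
    ENNReal.ofReal c * volume phaseDom ≤
      (∫⁻ v in phaseDom, Bᶜ.indicator (fun _ => ENNReal.ofReal c) (μ.restrict (rootCell L v))) +
        ENNReal.ofReal c * (6 * ENNReal.ofReal (r / L)) := by
  obtain ⟨S, -, hsep, rfl⟩ := hμ
  -- the good phases fill the cube up to six slabs of width `r/L = 2/(2L/r)`
  have hvol : volume phaseDom ≤
      volume {v : E3 | ∀ i, r / L < v i ∧ v i < 1 - r / L} + 6 * ENNReal.ofReal (r / L) := by
    have h2 : 2 / (2 * L / r) = r / L := by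
      rw [div_div_eq_mul_div, mul_div_mul_left _ _ (two_ne_zero' ℝ)]
    have h := volume_phaseDom_le_add (2 * L / r)
    simp only [h2] at h
    exact h
  set Good : Set E3 := {v : E3 | ∀ i, r / L < v i ∧ v i < 1 - r / L} with hGood
  have hGm : MeasurableSet Good := by
    have h : Good = ⋂ i, (fun v : E3 => v i) ⁻¹' Ioo (r / L) (1 - r / L) := by
      ext v
      simp only [hGood, mem_setOf_eq, mem_iInter, mem_preimage, mem_Ioo]
    rw [h]
    exact MeasurableSet.iInter fun i => measurable_coord i measurableSet_Ioo
  have hrL : 0 ≤ r / L := div_nonneg hr.le hL.le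
  have hGsub : Good ⊆ phaseDom := fun v hv => mem_phaseDom.2 fun i => by
    have hvi : r / L < v i ∧ v i < 1 - r / L := hv i
    constructor <;> linarith [hvi.1, hvi.2]
  -- on the good phases the cell cluster decides `G`
  have hval : ∀ v ∈ Good, Bᶜ.indicator (fun _ => ENNReal.ofReal c)
      (((Measure.count : Measure E3).restrict S).restrict (rootCell L v)) = ENNReal.ofReal c := by
    intro v hv
    have hball := closedBall_subset_rootCell hL (v := v) hv
    have hfin : (rootCell L v ∩ S).Finite :=
      (UniformlyDiscrete.finite_inter_closedBall ⟨δ, hδ, hsep⟩ 0 (2 * L)).subset fun z hz =>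
        ⟨hz.2, rootCell_subset_closedBall hL v hz.1⟩
    rw [Measure.restrict_restrict (measurableSet_rootCell L v)]
    refine indicator_of_mem (mem_compl fun hB => hGμ ?_) _
    have hGF : G ((Measure.count : Measure E3).restrict (rootCell L v ∩ S)) := (hBG _ hfin).1 hB
    refine (hloc ((Measure.count : Measure E3).restrict (rootCell L v ∩ S))
      ((Measure.count : Measure E3).restrict S) fun w hw => ?_).1 hGF
    rw [count_restrict_singleton_ne_zero_iff, count_restrict_singleton_ne_zero_iff]
    exact ⟨fun h => h.2, fun h => ⟨hball (mem_closedBall_zero_iff.2 hw), h⟩⟩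
  have hint : ENNReal.ofReal c * volume Good ≤ ∫⁻ v in phaseDom, Bᶜ.indicator (fun _ => ENNReal.ofReal c)
      (((Measure.count : Measure E3).restrict S).restrict (rootCell L v)) := by
    calc ENNReal.ofReal c * volume Good
        = ENNReal.ofReal c * ((volume : Measure E3).restrict phaseDom) Good := by
          rw [Measure.restrict_apply hGm, inter_eq_left.2 hGsub]
      _ = ∫⁻ v in phaseDom, Good.indicator (fun _ => ENNReal.ofReal c) v :=
          (lintegral_indicator_const hGm _).symm
      _ ≤ _ := lintegral_mono fun v => by
          by_cases hv : v ∈ Good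
          · rw [indicator_of_mem hv, hval v hv]
          · rw [indicator_of_notMem hv]; exact zero_le
  calc ENNReal.ofReal c * volume phaseDom
      ≤ ENNReal.ofReal c * (volume Good + 6 * ENNReal.ofReal (r / L)) := mul_le_mul' le_rfl hvol
    _ = ENNReal.ofReal c * volume Good + ENNReal.ofReal c * (6 * ENNReal.ofReal (r / L)) := mul_add _ _ _
    _ ≤ _ := add_le_add hint le_rfl

/-! ## The assembly, for an abstract defect transport -/

/-- **Assembly of the local-defect certificates** for an abstract family of defect transports `T c δ L`
(jointly measurable, bounded by `c·vol [0,1)³` on rooted hard-core inputs, of range `2L`, with the sent /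
received bookkeeping of the line's defect transport read through the proxy `B` of `G`, and the surcharged
periodisation): the finite defect inequality with constant `c > 0` gives, for every `ε > 0`, an admissible
transfer with `e* − ε ≤ h + div t` at every rooted `δ`-hard-core configuration and `e* + c/2 ≤ h + div t`
at every one with `¬ G` (`CapAssembly.assembly` with `local_bonus` and the mesh `L ≥ 24 r / vol`). -/
theorem assembly {G : Measure E3 → Prop} {r : ℝ} (hr : 0 < r)
    (hloc : ∀ μ ν : Measure E3, (∀ w : E3, ‖w‖ ≤ r → (μ {w} ≠ 0 ↔ ν {w} ≠ 0)) → (G μ ↔ G ν))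
    {B : Set (Measure E3)}
    (hBG : ∀ F : Set E3, F.Finite →
      ((Measure.count : Measure E3).restrict F ∈ B ↔ G ((Measure.count : Measure E3).restrict F)))
    {T : ℝ → ℝ → ℝ → Measure E3 → E3 → ℝ≥0∞}
    (hSent : ∀ c δ L : ℝ, 0 < δ → 0 < L → Measurable (Function.uncurry (T c δ L)) ∧
      ∀ μ : Measure E3, IsRootedHardCore δ μ → ∫⁻ y, T c δ L μ y ∂μ =
        ∫⁻ v in phaseDom, (∫⁻ y in rootCell L v, Bᶜ.indicator (fun _ => ENNReal.ofReal c)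
          ((μ.restrict (rootCell L v)).map (fun z => z - y)) ∂μ) / μ (rootCell L v))
    (hRecv : ∀ c δ L : ℝ, 0 < δ → 0 < L → ∀ μ : Measure E3, IsRootedHardCore δ μ →
      ∫⁻ y, T c δ L (μ.map fun z => z - y) (-y) ∂μ =
        ∫⁻ v in phaseDom, Bᶜ.indicator (fun _ => ENNReal.ofReal c) (μ.restrict (rootCell L v)))
    (hSur : ∀ c δ₀ δ L : ℝ, 0 ≤ c → 0 < δ₀ → δ₀ ≤ δ → 0 < L → -cst δ₀ ≤ eStar →
      (∀ (N : ℕ) (y : Fin N → E3), Function.Injective y → (∀ i j : Fin N, i ≠ j → δ ≤ dist (y i) (y j)) →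
        (N : ℝ) * eStar + c * (Nat.card {i : Fin N //
            (Measure.count : Measure E3).restrict ((fun z => z - y i) '' Set.range y) ∉ B} : ℝ) ≤
          interactionEnergy lennardJones y) →
      ∀ μ : Measure E3, IsRootedHardCore δ μ →
        volume phaseDom * ENNReal.ofReal (eStar + cst δ₀) +
          ∫⁻ v in phaseDom, (∫⁻ y in rootCell L v, Bᶜ.indicator (fun _ => ENNReal.ofReal c)
            ((μ.restrict (rootCell L v)).map (fun z => z - y)) ∂μ) / μ (rootCell L v) ≤
        ∫⁻ y, transport δ₀ L (μ.map fun z => z - y) (-y) ∂μ)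
    (hTle : ∀ c δ L : ℝ, 0 < δ → ∀ ν : Measure E3, IsRootedHardCore δ ν → ∀ y,
      T c δ L ν y ≤ ENNReal.ofReal c * volume phaseDom)
    (hT0 : ∀ c δ L : ℝ, 0 < L → ∀ (ν : Measure E3) (y : E3), 2 * L < ‖y‖ → T c δ L ν y = 0) :
    ∀ δ : ℝ, 0 < δ → ∀ c : ℝ, 0 < c →
      (∀ (N : ℕ) (y : Fin N → E3), Function.Injective y → (∀ i j : Fin N, i ≠ j → δ ≤ dist (y i) (y j)) →
        (N : ℝ) * eStar + c * (Nat.card {i : Fin N //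
            ¬ G ((Measure.count : Measure E3).restrict ((fun z => z - y i) '' Set.range y))} : ℝ) ≤
          interactionEnergy lennardJones y) →
      ∀ ε : ℝ, 0 < ε → ∃ R M : ℝ, ∃ t : Measure E3 → E3 → ℝ, IsTransfer R M t ∧
        ∀ μ : Measure E3, IsRootedHardCore δ μ →
          eStar - ε ≤ rootEnergy lennardJones μ + transferDiv t μ ∧
          (¬ G μ → eStar + c / 2 ≤ rootEnergy lennardJones μ + transferDiv t μ) := by
  intro δ hδ c hc hfin ε hε
  -- the class parameter `δ₀`
  set δ₀ : ℝ := min δ (1 / 20) with hδ₀def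
  have hδ₀ : 0 < δ₀ := lt_min hδ (by norm_num)
  have hδ₀δ : δ₀ ≤ δ := min_le_left _ _
  have heS : -cst δ₀ ≤ eStar := neg_cst_le_eStar hδ₀ (min_le_right _ _)
  -- the finite inequality in `B`-form
  have hfinB : ∀ (N : ℕ) (y : Fin N → E3), Function.Injective y →
      (∀ i j : Fin N, i ≠ j → δ ≤ dist (y i) (y j)) →
      (N : ℝ) * eStar + c * (Nat.card {i : Fin N //
          (Measure.count : Measure E3).restrict ((fun z => z - y i) '' Set.range y) ∉ B} : ℝ) ≤
        interactionEnergy lennardJones y := by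
    intro N y hy hsep
    have hcard : Nat.card {i : Fin N //
        (Measure.count : Measure E3).restrict ((fun z => z - y i) '' Set.range y) ∉ B} =
        Nat.card {i : Fin N //
          ¬ G ((Measure.count : Measure E3).restrict ((fun z => z - y i) '' Set.range y))} :=
      Nat.card_congr (Equiv.subtypeEquivRight fun i =>
        not_congr (hBG _ ((Set.finite_range y).image _)))
    rw [hcard]
    exact hfin N y hy hsep
  -- the volume of the phase cube
  set D : ℝ≥0∞ := volume phaseDom with hD
  set d : ℝ := D.toReal with hd
  have hDtop : D ≠ ∞ := volume_phaseDom_ne_top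
  have hdpos : 0 < d := ENNReal.toReal_pos volume_phaseDom_ne_zero volume_phaseDom_ne_top
  -- the slack
  set η : ℝ := min ε (c / 4) with hηdef
  have hη : 0 < η := lt_min hε (by positivity)
  have hηε : η ≤ ε := min_le_left _ _
  have hηc : η ≤ c / 4 := min_le_right _ _
  -- the cut-off `ρ` and the mesh `L`
  set ρ : ℝ := max δ₀ (max 1 (1000 * δ₀⁻¹ ^ 4 / (6 * η))) with hρdef
  have hδρ : δ₀ ≤ ρ := le_max_left _ _
  have hρ1 : 1 ≤ ρ := (le_max_left _ _).trans (le_max_right _ _)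
  have hρA : 1000 * δ₀⁻¹ ^ 4 / (6 * η) ≤ ρ := (le_max_right _ _).trans (le_max_right _ _)
  have hρpos : 0 < ρ := one_pos.trans_le hρ1
  set L : ℝ := max ((250 * ρ * δ₀⁻¹ ^ 6 + d * η) / (d * η)) (24 * r / d) with hLdef
  have hdη : 0 < d * η := mul_pos hdpos hη
  have hL24 : 24 * r / d ≤ L := le_max_right _ _
  have hLpos : 0 < L := (div_pos (by positivity) hdη).trans_le (le_max_left _ _)
  have hLmul : 250 * ρ * δ₀⁻¹ ^ 6 + d * η ≤ d * η * L := by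
    have h : (250 * ρ * δ₀⁻¹ ^ 6 + d * η) / (d * η) ≤ L := le_max_left _ _
    rw [div_le_iff₀ hdη] at h
    linarith
  -- the uniform error is at most `12 · vol · η`
  have htail : 1000 * δ₀⁻¹ ^ 4 * ρ⁻¹ ^ 2 ≤ 6 * η := by
    have hρinv0 : 0 ≤ ρ⁻¹ := inv_nonneg.2 hρpos.le
    have hρinv1 : ρ⁻¹ ≤ 1 := inv_le_one_of_one_le₀ hρ1
    have hsq : ρ⁻¹ ^ 2 ≤ ρ⁻¹ := pow_le_of_le_one hρinv0 hρinv1 two_ne_zero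
    have hlin : 1000 * δ₀⁻¹ ^ 4 * ρ⁻¹ ≤ 6 * η := by
      rw [div_le_iff₀ (by positivity)] at hρA
      rw [← div_eq_mul_inv, div_le_iff₀ hρpos]
      linarith
    calc 1000 * δ₀⁻¹ ^ 4 * ρ⁻¹ ^ 2 ≤ 1000 * δ₀⁻¹ ^ 4 * ρ⁻¹ :=
        mul_le_mul_of_nonneg_left hsq (by positivity)
      _ ≤ 6 * η := hlin
  have hnear : 6 * (ρ / L) * (250 * δ₀⁻¹ ^ 6) ≤ 6 * (d * η) := by
    have h1 : 6 * (ρ / L) * (250 * δ₀⁻¹ ^ 6) = (1500 * ρ * δ₀⁻¹ ^ 6) / L := by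
      field_simp
      norm_num
    rw [h1, div_le_iff₀ hLpos]
    nlinarith [hLmul, hdη]
  have herrη : (6 * (ρ / L) * (250 * δ₀⁻¹ ^ 6) + d * (1000 * δ₀⁻¹ ^ 4 * ρ⁻¹ ^ 2)) / (12 * d) ≤ η := by
    rw [div_le_iff₀ (by positivity)]
    nlinarith [mul_le_mul_of_nonneg_left htail hdpos.le, hnear]
  -- `6 r / L ≤ vol / 4`
  have hLd : 6 * (r / L) ≤ d / 4 := by
    rw [mul_div_assoc', div_le_iff₀ hLpos]
    have h : 24 * r ≤ L * d := (div_le_iff₀ hdpos).1 hL24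
    linarith
  -- the bounds of the two transports
  set Mb : ℝ := (volume phaseDom * ENNReal.ofReal (250 / 24 * δ₀⁻¹ ^ 12 + cst δ₀)).toReal with hMb
  have hMb0 : 0 ≤ Mb := ENNReal.toReal_nonneg
  have hKtop : ENNReal.ofReal c * volume phaseDom ≠ ∞ := ENNReal.mul_ne_top ENNReal.ofReal_ne_top hDtop
  set Mc : ℝ := (ENNReal.ofReal c * volume phaseDom).toReal with hMc
  have hMc0 : 0 ≤ Mc := ENNReal.toReal_nonneg
  obtain ⟨hTm, hTsent⟩ := hSent c δ₀ L hδ₀ hLpos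
  -- the transfer
  set t : Measure E3 → E3 → ℝ := fun ν y =>
    -(d⁻¹ * (min (transport δ₀ L ν y).toReal Mb + min (T c δ₀ L ν y).toReal Mc)) with htdef
  refine ⟨2 * L, d⁻¹ * (Mb + Mc), t, ⟨?_, ?_, ?_⟩, fun μ hμ => ?_⟩
  · -- jointly measurable
    have h : Measurable fun p : Measure E3 × E3 =>
        -(d⁻¹ * (min (Function.uncurry (transport δ₀ L) p).toReal Mb +
          min (Function.uncurry (T c δ₀ L) p).toReal Mc)) :=
      ((((measurable_transport δ₀ L).ennreal_toReal.min measurable_const).add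
        (hTm.ennreal_toReal.min measurable_const)).const_mul _).neg
    exact h
  · -- bounded
    intro ν y
    have h1 : 0 ≤ min (transport δ₀ L ν y).toReal Mb := le_min ENNReal.toReal_nonneg hMb0
    have h2 : min (transport δ₀ L ν y).toReal Mb ≤ Mb := min_le_right _ _
    have h3 : 0 ≤ min (T c δ₀ L ν y).toReal Mc := le_min ENNReal.toReal_nonneg hMc0
    have h4 : min (T c δ₀ L ν y).toReal Mc ≤ Mc := min_le_right _ _
    show |-(d⁻¹ * (min (transport δ₀ L ν y).toReal Mb + min (T c δ₀ L ν y).toReal Mc))| ≤ d⁻¹ * (Mb + Mc)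
    rw [abs_neg, abs_of_nonneg (mul_nonneg (inv_nonneg.2 hdpos.le) (add_nonneg h1 h3))]
    exact mul_le_mul_of_nonneg_left (add_le_add h2 h4) (inv_nonneg.2 hdpos.le)
  · -- finite range
    intro ν y hy
    show -(d⁻¹ * (min (transport δ₀ L ν y).toReal Mb + min (T c δ₀ L ν y).toReal Mc)) = 0
    rw [transport_eq_zero_of_lt hLpos ν hy, hT0 c δ₀ L hLpos ν y hy, ENNReal.toReal_zero, min_eq_left hMb0,
      min_eq_left hMc0, add_zero, mul_zero, neg_zero]
  · -- the certificate
    have hμ₀ : IsRootedHardCore δ₀ μ := hμ.mono hδ₀δ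
    have hIN : volume phaseDom * ENNReal.ofReal (eStar + cst δ₀) + ∫⁻ y, T c δ₀ L μ y ∂μ ≤
        ∫⁻ y, transport δ₀ L (μ.map fun z => z - y) (-y) ∂μ := by
      rw [hTsent μ hμ₀]
      exact hSur c δ₀ δ L hc.le hδ₀ hδ₀δ hLpos heS hfinB μ hμ
    set ING : ℝ≥0∞ := ∫⁻ v in phaseDom, Bᶜ.indicator (fun _ => ENNReal.ofReal c) (μ.restrict (rootCell L v))
      with hINGdef
    have h := certificate hδ₀ hLpos hδρ hμ₀ hKtop hTm (hTle c δ₀ L hδ₀) (hT0 c δ₀ L hLpos) hIN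
    rw [hRecv c δ₀ L hδ₀ hLpos μ hμ₀, ← hD, ← hd] at h
    have hcert : eStar - (6 * (ρ / L) * (250 * δ₀⁻¹ ^ 6) + d * (1000 * δ₀⁻¹ ^ 4 * ρ⁻¹ ^ 2)) / (12 * d) +
        d⁻¹ * ING.toReal ≤ rootEnergy lennardJones μ + transferDiv t μ := h
    have hINGle : ING ≤ ENNReal.ofReal c * volume phaseDom := by
      calc ING ≤ ∫⁻ _ in phaseDom, ENNReal.ofReal c := lintegral_mono fun v => indicator_le_self _ _ _
        _ = ENNReal.ofReal c * volume phaseDom := setLIntegral_const _ _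
    have hINGtop : ING ≠ ∞ := ne_top_of_le_ne_top hKtop hINGle
    have hING0 : 0 ≤ d⁻¹ * ING.toReal := mul_nonneg (inv_nonneg.2 hdpos.le) ENNReal.toReal_nonneg
    refine ⟨by linarith, fun hGμ => ?_⟩
    -- the local bonus at a `¬ G` root
    have hbonus := local_bonus hr hloc hBG c hδ hLpos hμ hGμ
    have h6top : ENNReal.ofReal c * (6 * ENNReal.ofReal (r / L)) ≠ ∞ :=
      ENNReal.mul_ne_top ENNReal.ofReal_ne_top (ENNReal.mul_ne_top (by norm_num) ENNReal.ofReal_ne_top)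
    have hbr : c * d ≤ ING.toReal + c * (6 * (r / L)) := by
      have h1 := ENNReal.toReal_mono (ENNReal.add_ne_top.2 ⟨hINGtop, h6top⟩) hbonus
      rwa [ENNReal.toReal_add hINGtop h6top, ENNReal.toReal_mul, ENNReal.toReal_mul, ENNReal.toReal_mul,
        ENNReal.toReal_ofReal hc.le, ENNReal.toReal_ofReal (by positivity : (0 : ℝ) ≤ r / L), ← hD, ← hd,
        ENNReal.toReal_ofNat] at h1
    have h12 : c * (6 * (r / L)) ≤ c * (d / 4) := mul_le_mul_of_nonneg_left hLd hc.le
    have hkey : 3 * c / 4 ≤ d⁻¹ * ING.toReal := by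
      rw [le_inv_mul_iff₀ hdpos]
      linarith
    linarith

/-! ## The registered stub -/

/-- **STUB `stub_localDefectCertificates` of line `octahedral-annulus-mandate` — LOCAL-DEFECT CERTIFICATES.**
For a predicate `G` of configurations which is local at a radius `r > 0` and has a measurable proxy `B` on
finite counting measures, the finite defect inequality `N·e* + c·#{i | ¬ G (cluster re-rooted at y i)} ≤ 𝓔_N(y)`
over finite injective `δ`-separated clusters (`c > 0`) yields, for every `ε > 0`, an admissible transfer `t`
with `e* − ε ≤ h + div t` at every rooted `δ`-hard-core configuration and `e* + c/2 ≤ h + div t` at every one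
with `¬ G`.  Proof: `assembly` at the line's defect transport read through `B`
(`DefectTransportSent.stub_defectTransportSent`, `DefectTransportReceived.stub_defectTransportReceived`,
`SurchargedReceived.stub_surchargedReceived`, `CapAssembly.defect_le`, `CapAssembly.defect_eq_zero_of_lt`). -/
theorem stub_localDefectCertificates : ∀ (G : Measure E3 → Prop) (r : ℝ), 0 < r → (∀ μ ν : Measure E3, (∀ w : E3, ‖w‖ ≤ r → (μ {w} ≠ 0 ↔ ν {w} ≠ 0)) → (G μ ↔ G ν)) → (∃ B : Set (Measure E3), MeasurableSet B ∧ ∀ F : Set E3, F.Finite → ((Measure.count : Measure E3).restrict F ∈ B ↔ G ((Measure.count : Measure E3).restrict F))) → ∀ δ : ℝ, 0 < δ → ∀ c : ℝ, 0 < c → (∀ (N : ℕ) (y : Fin N → E3), Function.Injective y → (∀ i j : Fin N, i ≠ j → δ ≤ dist (y i) (y j)) → (N : ℝ) * eStar + c * (Nat.card {i : Fin N // ¬ G ((Measure.count : Measure E3).restrict ((fun z => z - y i) '' Set.range y))} : ℝ) ≤ interactionEnergy lennardJones y) → ∀ ε : ℝ, 0 < ε → ∃ R M : ℝ, ∃ t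 : Measure E3 → E3 → ℝ, IsTransfer R M t ∧ ∀ μ : Measure E3, IsRootedHardCore δ μ → eStar - ε ≤ rootEnergy lennardJones μ + transferDiv t μ ∧ (¬ G μ → eStar + c / 2 ≤ rootEnergy lennardJones μ + transferDiv t μ) := by
  intro G r hr hloc hB
  obtain ⟨B, hBm, hBG⟩ := hB
  exact assembly hr hloc hBG (DefectTransportSent.stub_defectTransportSent B hBm)
    (DefectTransportReceived.stub_defectTransportReceived B hBm) (SurchargedReceived.stub_surchargedReceived B)
    (fun _ _ _ hδ _ hν y => defect_le hδ hν y) (fun _ _ _ hL ν _ hy => defect_eq_zero_of_lt hL ν hy)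

/-! ## The measure-level corollary: pricing of the defect event -/

/-- **Pricing of a local defect from the finite defect inequality.**  Under the hypotheses of
`stub_localDefectCertificates` (a predicate `G` local at radius `r > 0` with a measurable proxy on finite
counting measures, and the finite defect inequality with constant `c > 0` at hard core `δ`), every
point-stationary almost surely `δ`-hard-core probability law `P` on configurations prices the event `¬ G`
linearly: `e* + (c/2)·P{¬ G} ≤ E_P[h]` (`P{¬ G}` the outer measure).  Proof: the certificates of
`stub_localDefectCertificates` at slack `ε` fed to the Mecke pricing lemma `MeckePricing.stub_meckePricing_unfolded`
give `e* − ε + (c/2 + ε)·P{¬ G} ≤ E_P[h]`; let `ε → 0`. -/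
theorem pricing_of_finiteInequality : ∀ (G : Measure E3 → Prop) (r : ℝ), 0 < r →
    (∀ μ ν : Measure E3, (∀ w : E3, ‖w‖ ≤ r → (μ {w} ≠ 0 ↔ ν {w} ≠ 0)) → (G μ ↔ G ν)) →
    (∃ B : Set (Measure E3), MeasurableSet B ∧ ∀ F : Set E3, F.Finite →
      ((Measure.count : Measure E3).restrict F ∈ B ↔ G ((Measure.count : Measure E3).restrict F))) →
    ∀ δ : ℝ, 0 < δ → ∀ c : ℝ, 0 < c →
    (∀ (N : ℕ) (y : Fin N → E3), Function.Injective y → (∀ i j : Fin N, i ≠ j → δ ≤ dist (y i) (y j)) →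
      (N : ℝ) * eStar + c * (Nat.card {i : Fin N //
          ¬ G ((Measure.count : Measure E3).restrict ((fun z => z - y i) '' Set.range y))} : ℝ) ≤
        interactionEnergy lennardJones y) →
    ∀ P : Measure (Measure E3), IsProbabilityMeasure P → (∀ᵐ μ ∂P, IsRootedHardCore δ μ) →
      IsPointStationaryLaw P → eStar + c / 2 * (P {μ | ¬ G μ}).toReal ≤ meanRootEnergy P := by
  intro G r hr hloc hB δ hδ c hc hfin P hP hcore hstat
  refine le_of_forall_pos_le_add fun ε hε => ?_
  obtain ⟨R, M, t, ht, hpt⟩ := stub_localDefectCertificates G r hr hloc hB δ hδ c hc hfin ε hε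
  have hp0 : 0 ≤ (P {μ | ¬ G μ}).toReal := ENNReal.toReal_nonneg
  have key : eStar - ε + (c / 2 + ε) * (P {μ | ¬ G μ}).toReal ≤ meanRootEnergy P :=
    MeckePricing.stub_meckePricing_unfolded δ hδ P hP hcore hstat R M t ht G (eStar - ε) (c / 2 + ε)
      (by linarith) (fun μ hμ => ⟨(hpt μ hμ).1, fun hG => by
        have h' := (hpt μ hμ).2 hG
        unfold transferDiv at h'
        linarith⟩)
  have hεp : 0 ≤ ε * (P {μ | ¬ G μ}).toReal := mul_nonneg hε.le hp0
  nlinarith [key, hεp]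

end Summit.AtomisticToContinuum.Crystallization.Theorems.PalmUnimodularRigidityMinimiserShells.LocalDefectCertificates

end
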